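/-
Copyright (c) 2026 the pub-hodgecm-mathlib formalisation cell (harness21).  Prover seat hodgecm-mathlib-F0P3a-p01 (g18): road «S3-ram» (LEAD F0P3a-plan (g13);
owner F0P3a-p06), (Cnt2′) route B (chair F0P3a-p07 (g15) RULING (16)(c)), organ «REGIMES A-ODD ∕ C HYPERBOLIC ROOT CENSUS», lattice half; 2026-09-02.
-/
import Literature.NumberTheory.Rogawski1990.DepthZeroKappaTransferOddLevelTokenSlices       -- ★ (K2) p849143 (A-p12 (g25)): `offRegion_tokenSlices_of_lineCounts_of_odd`
import Literature.NumberTheory.Automorphic.UnitaryLatticeTreeBlockRootRegionAxisTop         -- ★ p849253 ∕ p849222 ∕ p849125 (this seat): tube exclusion, `v_det_le_of_entries_le_of_mulVec_le`, `Φ₂` pairing lemmas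
import HarnessLib

/-!
# The ramified `κ`-orbital integral, ROUTE B: THE ROOT CENSUS OF THE HYPERBOLIC TYPE-(2) LITERAL IN REGIMES A-ODD ∕ C (lattice half)
# (Kottwitz 1986 §3; Rogawski 1990 §4.9; Labesse–Langlands 1979 §2)

Topic `NumberTheory/Rogawski1990`; namespace `Literature.NumberTheory.Rogawski1990.TypeOneRamifiedJunction` (the raw head's namespace).  THEOREMS ONLY (no definition, no
instance, no notation, no named fact, no `sorry`); kernel lane `--supports stmt-HodgeConjecture-24833`; datum-free (`K` with `Valued K ℤᵐ⁰`).  Cell `pub/hodgecm-mathlib`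
(D-0151), crux H413; road «S3-ram» (count-neutral); (Cnt2′) ROUTE B, heir chair F0P3a-p07 (g15) RULING (16)(c) → F0P3a-p01 (g18): the ROOT CENSUS of the (scalar- and
W-centred, ★ (h1) A-p19 (g29)) HYPERBOLIC block literal `γ = ι(B₀, 1) ∈ K₀` of the `J₀`-model when the root `r₀` has the TOP odd level `d₀ = N` (regimes A-odd ∕ C of the
(α) v2.1 skeleton: cells `stub_Zpair_zero_odd_A`, `stub_T2G_pm_odd_J0diff_A`; pens F0P3a-p08 (g20) ∕ A-p16 (g33); finite half F0P3a-p02 (g18) SHAPE (ii)).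

THE MATHEMATICS.  `Φ₃ = ι-shape(Φ₂, 1)`, `Φ₂ = !![0,1;1,0]`; `γ = ι(B₀, 1)` with `(B₀ − 1)·𝒪² ≤ ϖ^{d₀}𝒪²` (root level) and the VALUE-GAP hypothesis
`hχ : |t − 1| ≤ |ϖ|^{d₀} ⇒ |χ_{B₀}(t)| = |det(B₀ − t·1)| > |ϖ|^{2d₀+1}` (regimes A-odd ∕ C: `|¼disc| = |ϖ|^{2N}`, `d₀ = N`, and `disc` is no square residually —
`χ_{B₀}` irreducible + Hensel; the CM pens discharge it).  §1 `exists_v_vecTwo_eq_one_of_isotropic`: a primitive ISOTROPIC `x ∈ 𝒪³` has a unit `W`-coordinate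
(`⟨x,x⟩ = ⟨x_W,x_W⟩ + σ(x₁)x₁`).  §2 **NO CHILD LINE OF THE ROOT IS A RESIDUAL EIGENLINE** (`not_eigenline_root_of_lt_v_det`): for `κ ∈ K₀` the first-order eigenline test of ★
(K1)∕(K2) (`|M₁₀|, |M₂₀| ≤ |ϖ|^{d₀+1}`, `M = κ⁻¹(γ−1)κ`) would give `(B₀ − (1+λ)·1)·x_W ∈ ϖ^{d₀+1}𝒪²` for the unit-coordinate `x_W` (`x = κe₀`, `λ = M₀₀`), whence
`|χ_{B₀}(1+λ)| ≤ |ϖ|^{2d₀+1}` by the adjugate (★ `v_det_le_of_entries_le_of_mulVec_le`) — excluded by `hχ`.  §3 **THE ROOT REGION IS `{r₀}`** (`eq_root_of_mem_rootRegion_hyperbolic`):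
★ p849125 `ncard_rootRegion_eq_ncard_two_of_coe_eq_endoGL` (`hχ` at `t = 1`) counts it by the W-side top ball, which is `{𝒪²}` (hypothesis `hWtop` = ★ A-p12 top W-ball at odd `N`) —
the `hR` binder of ★ `strataCount_J₀_of_charpoly_block_raw_singleton`.  §4 **THE THREE ROOT SLICES FROM VALUE-ONLY LINE COUNTS** (`rootSlices_hyperbolic_of_lineCounts`): ★ (K2)
at `v = r₀`, `u = 1`, with the eigenline clause REMOVED by §2 — the `hNE hNP hNM` binders of the singleton head with `(NE, NP, NM) = q·(νE, νP, νM)`, `νX` = the number of child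
lines `κ·N₁` (`κ ∈ K₀`) whose value `(ϖ^{d₀})⁻¹⟨κe₀, (γ−1)κe₀⟩` is null ∕ of class `−c₁` ∕ of class `−c₁ε` (all `q+1` lines are counted: `νE + νP + νM = q+1` is the finite half's).
ED. 2 (append-only): §5 `rootRegionPackage_hyperbolic_of_lineCounts` = §3 + §4 packaged as the `(sR := {r₀}, hsR, PE PP PM, hPE hPP hPM)` inputs of ★ p849224
`strataCount_J₀_of_charpoly_block_raw_endoGL_one` ∕ ★ p849287 `hyperbolicTotal_zero_ram_of_region_census_odd` (pen F0P3a-p08 (g20)), `(PE, PP, PM) = q·(νE, νP, νM)`.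
HONEST LABEL: HC_CM is proved only modulo the 2 remaining named inputs (hLiu418 24832, h413 24833) until rung 0 closes; nothing printed is asserted here (lattice bookkeeping over ★
results); «S3-ram» is Literature seeding, count-neutral.

## References
* [Kottwitz1986] R. E. Kottwitz, *Base change for unit elements of Hecke algebras*, Compositio Math. 60 (1986), §3 (counting fixed lattices shell by shell).
* [Rogawski1990] J. D. Rogawski, *Automorphic Representations of Unitary Groups in Three Variables*, Ann. of Math. Stud. 123 (1990), §4.9 pp. 54–56, Prop. 4.9.1.
* [LabesseLanglands1979] J.-P. Labesse, R. P. Langlands, *L-indistinguishability for SL(2)*, Canad. J. Math. 31 (1979), §2 (κ-signed counts over the four literals).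
* [BruhatTits1972] F. Bruhat, J. Tits, *Groupes réductifs sur un corps local I*, Publ. Math. IHÉS 41 (1972), §10 (lattice models of the building).
* [Serre1980Trees] J.-P. Serre, *Trees* (1980), I.2.3, II.1.1.
-/

set_option autoImplicit false

noncomputable section

open scoped Valued WithZero Matrix MatrixGroups
open Polynomial Classical SimpleGraph
open Literature.NumberTheory.Automorphic Literature.NumberTheory.Automorphic.HermitianLattice Literature.NumberTheory.Automorphic.UnitaryLatticeTree

namespace Literature.NumberTheory.Rogawski1990.TypeOneRamifiedJunction

variable {K : Type*} [Field K] [Valued K ℤᵐ⁰] {σ : K →+* K} {ϖ : K}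

/-! ## §1 A primitive isotropic vector of the `J₀`-model has a unit `W`-coordinate -/

/-- For `x ∈ 𝒪³` with a unit coordinate and `⟨x, x⟩_{Φ₃} = 0`: one of `x₀, x₂` is a unit (`⟨x,x⟩ = ⟨x_W, x_W⟩_{Φ₂} + σ(x₁)x₁`, so a non-unit `x_W` forces a non-unit `x₁`).
[cite: BruhatTits1972, §10] [cite: Serre1980Trees, II.1.1] -/
theorem exists_v_vecTwo_eq_one_of_isotropic (hvσ : ∀ a, Valued.v (σ a) = Valued.v a) (hϖ : Valued.v ϖ = WithZero.exp (-1 : ℤ))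
    {x : Fin 3 → K} (hx : ∀ i, Valued.v (x i) ≤ 1) (hunit : ∃ i, Valued.v (x i) = 1)
    (hiso : pairing σ ((StdForm.antidiagonal 3).over K) x x = 0) :
    ∃ i, Valued.v ((![x 0, x 2] : Fin 2 → K) i) = 1 := by
  have hϖ1 : Valued.v ϖ < 1 := by rw [hϖ, ← WithZero.exp_zero]; exact WithZero.exp_lt_exp.2 (by norm_num)
  by_contra hno
  have hno' : ∀ i, Valued.v ((![x 0, x 2] : Fin 2 → K) i) ≠ 1 := fun i hi => hno ⟨i, hi⟩
  have hW1 : ∀ i, Valued.v ((![x 0, x 2] : Fin 2 → K) i) ≤ 1 := fun i => by fin_cases i <;> simp [hx]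
  have hWlt : ∀ i, Valued.v ((![x 0, x 2] : Fin 2 → K) i) ≤ Valued.v ϖ := fun i => by
    rw [hϖ]; exact (v_lt_one_iff _).1 (lt_of_le_of_ne (hW1 i) (hno' i))
  rw [antidiagonal_three_over_eq_endoShape, pairing_endoShape_apply, mul_one] at hiso
  -- `σ(x₁)·x₁ = −⟨x_W, x_W⟩` is small, so `x₁` is not a unit; and `x₀, x₂` are not units: no unit coordinate
  have hsmall : Valued.v (σ (x 1) * x 1) ≤ Valued.v ϖ * Valued.v ϖ := by
    have e : σ (x 1) * x 1 = -(pairing σ (!![(0 : K), 1; 1, 0] : Matrix (Fin 2) (Fin 2) K) ![x 0, x 2] ![x 0, x 2]) := eq_neg_of_add_eq_zero_right hiso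
    rw [e, Valuation.map_neg]
    exact v_pairing_antidiag_two_le hvσ hWlt hWlt
  obtain ⟨i, hi⟩ := hunit
  fin_cases i
  · exact hno' 0 (by simpa using hi)
  · have hi' : Valued.v (x 1) = 1 := by simpa using hi
    have h1 : Valued.v (σ (x 1) * x 1) = 1 := by rw [map_mul, hvσ, hi', one_mul]
    rw [h1] at hsmall
    exact absurd hsmall (not_le.2 (mul_lt_one_of_nonneg_of_lt_one_left zero_le hϖ1 hϖ1.le))
  · exact hno' 1 (by simpa using hi)

/-! ## §2 No child line of the root is a residual eigenline (regimes A-odd ∕ C of the hyperbolic literal) -/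

set_option maxHeartbeats 800000 in -- budget only: block tokens.
/-- **NO EIGENLINE CHILD AT THE HYPERBOLIC ROOT.**  `γ ∈ U(σ, Φ₃)` with matrix `ι(B₀, 1)`, `(B₀ − 1)` of level `ϖ^{d₀}`, and the VALUE GAP `hχ`: `|det(B₀ − t·1)| > |ϖ|^{2d₀+1}`
whenever `|t − 1| ≤ |ϖ^{d₀}|`.  Then for every `κ ∈ K₀` the first-order eigenline test of ★ (K1)∕(K2) FAILS: `¬ (|M₁₀| ≤ |ϖ|^{d₀+1} ∧ |M₂₀| ≤ |ϖ|^{d₀+1})`, `M = κ⁻¹(γ−1)κ`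
(so ★ (K2)'s child sets at the root are value-only).  [cite: Kottwitz1986, §3] [cite: BruhatTits1972, §10] [cite: LabesseLanglands1979, §2] -/
theorem not_eigenline_root_of_lt_v_det (hvσ : ∀ a, Valued.v (σ a) = Valued.v a) (hϖ : Valued.v ϖ = WithZero.exp (-1 : ℤ))
    {γ : unitaryGroupOfForm σ ((StdForm.antidiagonal 3).over K)} (B₀ : GL (Fin 2) K) (hγ : (γ : GL (Fin 3) K) = endoGL (B₀, (1 : GL (Fin 1) K))) {d₀ : ℕ}
    (hB : ∀ i j, Valued.v (((B₀ : Matrix (Fin 2) (Fin 2) K) - 1) i j) ≤ Valued.v (ϖ ^ d₀))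
    (hχ : ∀ t : K, Valued.v (t - 1) ≤ Valued.v (ϖ ^ d₀) →
      Valued.v ϖ ^ (2 * d₀ + 1) < Valued.v (((B₀ : Matrix (Fin 2) (Fin 2) K) - t • (1 : Matrix (Fin 2) (Fin 2) K)).det))
    (κ : unitaryGroupOfForm σ ((StdForm.antidiagonal 3).over K)) (hκ : κ ∈ unitaryInt σ ((StdForm.antidiagonal 3).over K)) :
    ¬ (Valued.v (((((((κ : unitaryGroupOfForm σ ((StdForm.antidiagonal 3).over K)) : GL (Fin 3) K))⁻¹ : GL (Fin 3) K) : Matrix (Fin 3) (Fin 3) K) * (((γ : GL (Fin 3) K) : Matrix (Fin 3) (Fin 3) K) - 1) * (((κ : unitaryGroupOfForm σ ((StdForm.antidiagonal 3).over K)) : GL (Fin 3) K) : Matrix (Fin 3) (Fin 3) K)) 1 0) ≤ Valued.v ϖ ^ (d₀ + 1) ∧ Valued.v (((((((κ : unitaryGroupOfForm σ ((StdForm.antidiagonal 3).over K)) : GL (Fin 3) K))⁻¹ : GL (Fin 3) K) : Matrix (Fin 3) (Fin 3) K) * (((γ : GL (Fin 3) K) : Matrix (Fin 3) (Fin 3)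 K) - 1) * (((κ : unitaryGroupOfForm σ ((StdForm.antidiagonal 3).over K)) : GL (Fin 3) K) : Matrix (Fin 3) (Fin 3) K)) 2 0) ≤ Valued.v ϖ ^ (d₀ + 1)) := by
  rintro ⟨h10, h20⟩
  have hϖ0' : Valued.v ϖ ≠ 0 := by rw [hϖ]; exact WithZero.exp_ne_zero
  have hϖ0 : ϖ ≠ 0 := fun h0 => by rw [h0, map_zero] at hϖ0'; exact hϖ0' rfl
  have hϖ1 : Valued.v ϖ < 1 := by rw [hϖ, ← WithZero.exp_zero]; exact WithZero.exp_lt_exp.2 (by norm_num)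
  obtain ⟨hκi, hκi'⟩ := mem_unitaryInt_iff.1 hκ
  set κm : Matrix (Fin 3) (Fin 3) K := ((κ : GL (Fin 3) K) : Matrix (Fin 3) (Fin 3) K) with hκmdef
  set κi : Matrix (Fin 3) (Fin 3) K := ((((κ : GL (Fin 3) K))⁻¹ : GL (Fin 3) K) : Matrix (Fin 3) (Fin 3) K) with hκidef
  set S : Matrix (Fin 3) (Fin 3) K := (((γ : GL (Fin 3) K) : Matrix (Fin 3) (Fin 3) K) - 1) with hSdef
  set M : Matrix (Fin 3) (Fin 3) K := κi * S * κm with hMdef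
  -- the line vector `x = κe₀`: integral, with a unit coordinate, isotropic
  set x : Fin 3 → K := κm *ᵥ (Pi.single 0 1 : Fin 3 → K) with hxdef
  have hxcol : ∀ i, x i = κm i 0 := fun i => by rw [hxdef, Matrix.mulVec_single_one]; rfl
  have hx : ∀ i, Valued.v (x i) ≤ 1 := fun i => by rw [hxcol]; exact hκi i 0
  have hκκ : κi * κm = 1 := by rw [hκidef, hκmdef, ← Units.val_mul, inv_mul_cancel, Units.val_one]
  have hunit : ∃ i, Valued.v (x i) = 1 := by
    by_contra hno
    have hlt : ∀ i, Valued.v (x i) ≤ Valued.v ϖ := fun i => by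
      rw [hϖ]; exact (v_lt_one_iff _).1 (lt_of_le_of_ne (hx i) (fun h => hno ⟨i, h⟩))
    -- `(κ⁻¹ x)₀ = 1` but every `|x_j| ≤ |ϖ|`
    have e1 : (κi *ᵥ x) 0 = 1 := by
      rw [hxdef, Matrix.mulVec_mulVec, hκκ, Matrix.one_mulVec]; simp
    have hle : Valued.v ((κi *ᵥ x) 0) ≤ Valued.v ϖ := by
      simp only [Matrix.mulVec, dotProduct]
      refine Valuation.map_sum_le _ fun j _ => ?_
      rw [map_mul]; exact mul_le_of_le_one_of_le (hκi' 0 j) (hlt j)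
    rw [e1, map_one] at hle
    exact absurd hle (not_le.2 hϖ1)
  have hiso : pairing σ ((StdForm.antidiagonal 3).over K) x x = 0 := by
    rw [hxdef, pairing_mulVec_mulVec_of_mem_unitary κ.2, antidiagonal_three_over_eq_endoShape, pairing_endoShape_apply, pairing_antidiag_two_apply]
    simp
  obtain ⟨i₀, hi₀⟩ := exists_v_vecTwo_eq_one_of_isotropic hvσ hϖ hx hunit hiso
  -- entries of `S = ι(B₀ − 1, 0)` and of `M = κ⁻¹Sκ`
  have hS : ∀ i j, Valued.v (S i j) ≤ Valued.v (ϖ ^ d₀) := by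
    rw [hSdef, hγ, coe_endoGL_sub_one_eq_endoShape, forall_v_endoShape_le_iff]
    refine ⟨hB, ?_⟩
    rw [Units.val_one, Matrix.one_apply_eq, sub_self, map_zero]; exact zero_le
  have hM : ∀ i j, Valued.v (M i j) ≤ Valued.v (ϖ ^ d₀) := v_mul_mul_apply_le_of_le hκi' hS hκi
  -- `S x = κ (M e₀)` and `M e₀ = λ e₀ + (0, M₁₀, M₂₀)`
  have hSx : S *ᵥ x = κm *ᵥ (M *ᵥ (Pi.single 0 1 : Fin 3 → K)) := by
    rw [hxdef, Matrix.mulVec_mulVec, Matrix.mulVec_mulVec, hMdef, ← Matrix.mul_assoc, ← Matrix.mul_assoc, hκmdef, hκidef, ← Units.val_mul, mul_inv_cancel, Units.val_one,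
      Matrix.one_mul]
  set lam : K := M 0 0 with hlamdef
  have hlam : Valued.v lam ≤ Valued.v (ϖ ^ d₀) := hM 0 0
  have hMe : M *ᵥ (Pi.single 0 1 : Fin 3 → K) = lam • (Pi.single 0 1 : Fin 3 → K) + ![0, M 1 0, M 2 0] := by
    ext i; rw [Matrix.mulVec_single_one]; fin_cases i <;> simp [hlamdef]
  have hr : ∀ i, Valued.v ((S *ᵥ x - lam • x) i) ≤ Valued.v ϖ ^ (d₀ + 1) := by
    have e : S *ᵥ x - lam • x = κm *ᵥ ![0, M 1 0, M 2 0] := by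
      rw [hSx, hMe, Matrix.mulVec_add, Matrix.mulVec_smul, ← hxdef, add_sub_cancel_left]
    intro i
    rw [e]
    simp only [Matrix.mulVec, dotProduct, Fin.sum_univ_three]
    refine (Valuation.map_add _ _ _).trans (max_le ((Valuation.map_add _ _ _).trans (max_le ?_ ?_)) ?_)
    · simp
    · rw [map_mul]; exact mul_le_of_le_one_of_le (hκi i 1) (by simpa using h10)
    · rw [map_mul]; exact mul_le_of_le_one_of_le (hκi i 2) (by simpa using h20)
  -- the `W`-part: `P·x_W` is small for `P = B₀ − (1 + λ)·1`
  set P : Matrix (Fin 2) (Fin 2) K := (B₀ : Matrix (Fin 2) (Fin 2) K) - (1 + lam) • (1 : Matrix (Fin 2) (Fin 2) K) with hPdef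
  have hPent : ∀ i k, Valued.v (P i k) ≤ Valued.v (ϖ ^ d₀) := by
    intro i k
    have e : P i k = ((B₀ : Matrix (Fin 2) (Fin 2) K) - 1) i k - lam * (1 : Matrix (Fin 2) (Fin 2) K) i k := by
      rw [hPdef, Matrix.sub_apply, Matrix.sub_apply, Matrix.smul_apply, smul_eq_mul, add_mul, one_mul]; ring
    rw [e]
    refine (Valuation.map_sub _ _ _).trans (max_le (hB i k) ?_)
    by_cases hik : i = k
    · rw [hik, Matrix.one_apply_eq, mul_one]; exact hlam
    · rw [Matrix.one_apply_ne hik, mul_zero, map_zero]; exact zero_le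
  have hSW : S *ᵥ x = ![((((B₀ : Matrix (Fin 2) (Fin 2) K) - ((1 : GL (Fin 1) K) : Matrix (Fin 1) (Fin 1) K) 0 0 • (1 : Matrix (Fin 2) (Fin 2) K))) *ᵥ ![x 0, x 2]) 0, 0,
      ((((B₀ : Matrix (Fin 2) (Fin 2) K) - ((1 : GL (Fin 1) K) : Matrix (Fin 1) (Fin 1) K) 0 0 • (1 : Matrix (Fin 2) (Fin 2) K))) *ᵥ ![x 0, x 2]) 1] := by
    rw [hSdef, hγ, ← endoGL_sub_smul_one_mulVec_eq B₀ (1 : GL (Fin 1) K) x, Units.val_one, Matrix.one_apply_eq, one_smul]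
  have hu1 : ((1 : GL (Fin 1) K) : Matrix (Fin 1) (Fin 1) K) 0 0 = 1 := by rw [Units.val_one, Matrix.one_apply_eq]
  rw [hu1, one_smul] at hSW
  have hPx : ∀ i, Valued.v ((P *ᵥ ![x 0, x 2]) i) ≤ Valued.v ϖ ^ (d₀ + 1) := by
    have e : P *ᵥ ![x 0, x 2] = (((B₀ : Matrix (Fin 2) (Fin 2) K) - 1) *ᵥ ![x 0, x 2]) - lam • ![x 0, x 2] := by
      rw [hPdef, add_smul, one_smul, ← sub_sub, Matrix.sub_mulVec, Matrix.smul_mulVec, Matrix.one_mulVec]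
    intro i
    fin_cases i
    · have h := hr 0
      rw [Pi.sub_apply, hSW, Pi.smul_apply] at h
      simpa [e] using h
    · have h := hr 2
      rw [Pi.sub_apply, hSW, Pi.smul_apply] at h
      simpa [e] using h
  -- the adjugate bound contradicts the value gap at `t = 1 + λ`
  have hdet := v_det_le_of_entries_le_of_mulVec_le P hPent hi₀ hPx
  have ht : Valued.v ((1 + lam) - 1) ≤ Valued.v (ϖ ^ d₀) := by rw [add_sub_cancel_left]; exact hlam
  have hgap := hχ (1 + lam) ht
  rw [← hPdef] at hgap
  have hbd : Valued.v (ϖ ^ d₀) * Valued.v ϖ ^ (d₀ + 1) = Valued.v ϖ ^ (2 * d₀ + 1) := by rw [map_pow, ← pow_add]; congr 1; omega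
  rw [hbd] at hdet
  exact absurd (hgap.trans_le hdet) (lt_irrefl _)

/-! ## §3 The root region of the hyperbolic literal at the top odd level is the root -/

set_option maxHeartbeats 800000 in -- budget only: lattice tokens.
/-- **THE ROOT REGION IS `{r₀}`** — the `hR` binder of ★ `strataCount_J₀_of_charpoly_block_raw_singleton` (F0P2-p02 (g14)) at the hyperbolic block literal `ι(γ₂, u)`:
every vertex of `{v ∣ γ·v = v ∧ SD v.1 ∧ (γ−1)·v.1 ≤ ϖ^{d₀}·v.1}` is an axis vertex (★ p849125, det criterion `|det(γ₂ − u₀₀·1)| > |ϖ|^{2d₀+1}`), the axis part is counted by the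
W-side set `{B ∣ SD_{Φ₂} B ∧ γ₂B = B ∧ (γ₂−1)B ≤ ϖ^{d₀}B}` (★ `ncard_rootRegion_eq_ncard_two_of_coe_eq_endoGL`), and that set is `{𝒪²}` at the top odd W-depth (`hWtop`: ★ A-p12 W-ball).
[cite: Kottwitz1986, §3] [cite: BruhatTits1972, §10] [cite: Rogawski1990, §4.9 pp. 54–56] -/
theorem eq_root_of_mem_rootRegion_of_lt_v_det [IsPrincipalIdealRing 𝒪[K]]
    (hσ : ∀ a, σ (σ a) = a) (hvσ : ∀ a, Valued.v (σ a) = Valued.v a) (hϖ : Valued.v ϖ = WithZero.exp (-1 : ℤ))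
    (γ : unitaryGroupOfForm σ ((StdForm.antidiagonal 3).over K)) (hγ0 : γ ∈ unitaryInt σ ((StdForm.antidiagonal 3).over K))
    (γ₂ : GL (Fin 2) K) (u : GL (Fin 1) K) (hγ : (γ : GL (Fin 3) K) = endoGL (γ₂, u))
    (hu : Valued.v ((u : Matrix (Fin 1) (Fin 1) K) 0 0) = 1) {d₀ : ℕ} (hud : Valued.v ((u : Matrix (Fin 1) (Fin 1) K) 0 0 - 1) ≤ Valued.v (ϖ ^ d₀))
    (hdet : Valued.v ϖ ^ (2 * d₀ + 1) <
      Valued.v (((γ₂ : Matrix (Fin 2) (Fin 2) K) - (u : Matrix (Fin 1) (Fin 1) K) 0 0 • (1 : Matrix (Fin 2) (Fin 2) K)).det))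
    (hroot : (stdLattice K 3).map ((Matrix.toLin' (((γ : GL (Fin 3) K) : Matrix (Fin 3) (Fin 3) K) - 1)).restrictScalars 𝒪[K]) ≤ scaleLattice (ϖ ^ d₀) (stdLattice K 3))
    (hWtop : {B : Submodule 𝒪[K] (Fin 2 → K) | IsSelfDualLattice σ ϖ (!![(0 : K), 1; 1, 0] : Matrix (Fin 2) (Fin 2) K) B ∧ mapGL γ₂ B = B ∧
        B.map ((Matrix.toLin' ((γ₂ : Matrix (Fin 2) (Fin 2) K) - 1)).restrictScalars 𝒪[K]) ≤ scaleLattice (ϖ ^ d₀) B} = {stdLattice K 2}) :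
    ∀ v, v ∈ {v : {M : Submodule 𝒪[K] (Fin 3 → K) // IsVertex σ ϖ ((StdForm.antidiagonal 3).over K) M} | latticeGraphIso σ ϖ ((StdForm.antidiagonal 3).over K) γ v = v ∧ IsSelfDualLattice σ ϖ ((StdForm.antidiagonal 3).over K) v.1 ∧ v.1.map ((Matrix.toLin' (((γ : GL (Fin 3) K) : Matrix (Fin 3) (Fin 3) K) - 1)).restrictScalars 𝒪[K]) ≤ scaleLattice (ϖ ^ d₀) v.1} → v = (⟨stdLattice K 3, 0, isSelfDualLattice_stdLattice_three_of_v hϖ⟩ : {M : Submodule 𝒪[K] (Fin 3 → K) // IsVertex σ ϖ ((StdForm.antidiagonal 3).over K) M}) := by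
  intro v hv
  have hcard := ncard_rootRegion_eq_ncard_two_of_coe_eq_endoGL hσ hvσ hϖ γ γ₂ u hγ hu hud hdet
  rw [hWtop, Set.ncard_singleton] at hcard
  obtain ⟨a, ha⟩ := Set.ncard_eq_one.1 hcard
  have hr : (⟨stdLattice K 3, 0, isSelfDualLattice_stdLattice_three_of_v hϖ⟩ : {M : Submodule 𝒪[K] (Fin 3 → K) // IsVertex σ ϖ ((StdForm.antidiagonal 3).over K) M}) ∈ {v : {M : Submodule 𝒪[K] (Fin 3 → K) // IsVertex σ ϖ ((StdForm.antidiagonal 3).over K) M} | latticeGraphIso σ ϖ ((StdForm.antidiagonal 3).over K) γ v = v ∧ IsSelfDualLattice σ ϖ ((StdForm.antidiagonal 3).over K) v.1 ∧ v.1.map ((Matrix.toLin' (((γ : GL (Fin 3) K) : Matrix (Fin 3) (Fin 3) K) - 1)).restrictScalars 𝒪[K]) ≤ scaleLattice (ϖ ^ d₀) v.1} := by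
    refine ⟨?_, isSelfDualLattice_stdLattice_three_of_v hϖ, hroot⟩
    apply Subtype.ext
    rw [latticeGraphIso_apply_coe]
    exact mapGL_stdLattice_of_mem_unitaryInt hγ0
  rw [ha, Set.mem_singleton_iff] at hv hr
  rw [hv, hr]

/-! ## §4 The three root slices from VALUE-ONLY line counts (★ (K2) at `v = r₀` with the eigenline clause removed) -/

set_option maxHeartbeats 1600000 in -- budget only: statement-heavy lattice tokens (★ (K2)'s).
/-- **THE ROOT CENSUS OF THE HYPERBOLIC LITERAL IN REGIMES A-ODD ∕ C, LATTICE HALF** — the `hNE hNP hNM` binders of ★ `strataCount_J₀_of_charpoly_block_raw_singleton` at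
`γ = ι(B₀, 1) ∈ K₀` from VALUE-ONLY child-line counts: `#{GC w of r₀ ∣ ¬LEV(ϖ^{d₀}) ∧ E-token} = q·νE`, `#{… P-token ∧ CLS(c₁)} = q·νP`, `#{… P-token ∧ ¬CLS(c₁)} = q·νM`, where
`νE ∕ νP ∕ νM` count the child lines `κ·N₁` (`κ ∈ K₀`) of value `(ϖ^{d₀})⁻¹⟨κe₀, (γ−1)κe₀⟩` null ∕ of class `−c₁` ∕ of class `−c₁ε` — ★ (K2) at `v = r₀`, `u = 1`, its eigenline clause
discharged by §2 (value gap `hχ`).  ALL `q + 1` lines are counted; the finite half (which lines are null, class sums) is F0P3a-p02's. [cite: Kottwitz1986, §3]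
[cite: Rogawski1990, §4.9 pp. 54–56] [cite: LabesseLanglands1979, §2] [cite: BruhatTits1972, §10] -/
theorem rootSlices_hyperbolic_of_lineCounts (hσ : ∀ x, σ (σ x) = x) (hvσ : ∀ a, Valued.v (σ a) = Valued.v a) (hσϖ : σ ϖ = -ϖ)
    (hϖ : Valued.v ϖ = WithZero.exp (-1 : ℤ)) (hres : ∀ x : K, Valued.v x ≤ 1 → Valued.v (σ x - x) < 1) (h2 : Valued.v (2 : K) = 1) [Finite 𝓀[K]]
    (hT : (latticeGraph σ ϖ ((StdForm.antidiagonal 3).over K)).IsTree)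
    {γ : unitaryGroupOfForm σ ((StdForm.antidiagonal 3).over K)} (hγ0 : γ ∈ unitaryInt σ ((StdForm.antidiagonal 3).over K))
    (B₀ : GL (Fin 2) K) (hγ : (γ : GL (Fin 3) K) = endoGL (B₀, (1 : GL (Fin 1) K)))
    {d₀ : ℕ} (hd3 : 3 ≤ d₀) (hodd : Odd d₀)
    (hnil3 : ∀ (w : {M : Submodule 𝒪[K] (Fin 3 → K) // IsVertex σ ϖ ((StdForm.antidiagonal 3).over K) M}) (e : ℕ), e + 1 ≤ d₀ →
      w.1.map ((Matrix.toLin' (((γ : GL (Fin 3) K) : Matrix (Fin 3) (Fin 3) K) - 1)).restrictScalars 𝒪[K]) ≤ scaleLattice (ϖ ^ e) w.1 →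
      w.1.map ((Matrix.toLin' ((((γ : GL (Fin 3) K) : Matrix (Fin 3) (Fin 3) K) - 1) ^ 3)).restrictScalars 𝒪[K]) ≤ scaleLattice (ϖ ^ (3 * e + 1)) w.1)
    (hBm : ∀ i j, Valued.v (((B₀ : Matrix (Fin 2) (Fin 2) K) - 1) i j) ≤ Valued.v ϖ ^ d₀)
    (hχ : ∀ t : K, Valued.v (t - 1) ≤ Valued.v (ϖ ^ d₀) →
      Valued.v ϖ ^ (2 * d₀ + 1) < Valued.v (((B₀ : Matrix (Fin 2) (Fin 2) K) - t • (1 : Matrix (Fin 2) (Fin 2) K)).det))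
    (hroot : (stdLattice K 3).map ((Matrix.toLin' (((γ : GL (Fin 3) K) : Matrix (Fin 3) (Fin 3) K) - 1)).restrictScalars 𝒪[K]) ≤ scaleLattice (ϖ ^ d₀) (stdLattice K 3))
    (c₁ ε : K) (hc₁ : Valued.v c₁ = 1) (hεv : Valued.v ε = 1) (hε : ∀ z : K, Valued.v z ≤ 1 → Valued.v (z ^ 2 - ε) = 1)
    (νE νP νM : ℕ)
    (hνE : ({c : {M : Submodule 𝒪[K] (Fin 3 → K) // IsVertex σ ϖ ((StdForm.antidiagonal 3).over K) M} | (latticeGraph σ ϖ ((StdForm.antidiagonal 3).over K)).Adj (⟨stdLattice K 3, 0, isSelfDualLattice_stdLattice_three_of_v hϖ⟩ : {M : Submodule 𝒪[K] (Fin 3 → K) // IsVertex σ ϖ ((StdForm.antidiagonal 3).over K) M}) c ∧ (latticeGraph σ ϖ ((StdForm.antidiagonal 3).over K)).dist ⟨stdLattice K 3, 0, isSelfDualLattice_stdLattice_three_of_v hϖ⟩ c = (latticeGraph σ ϖ ((StdForm.antidiagonal 3).over K)).dist ⟨stdLattice K 3, 0, isSelfDualLattice_stdLattice_three_of_v hϖ⟩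 (⟨stdLattice K 3, 0, isSelfDualLattice_stdLattice_three_of_v hϖ⟩ : {M : Submodule 𝒪[K] (Fin 3 → K) // IsVertex σ ϖ ((StdForm.antidiagonal 3).over K) M}) + 1 ∧ ∃ κ : unitaryGroupOfForm σ ((StdForm.antidiagonal 3).over K), κ ∈ unitaryInt σ ((StdForm.antidiagonal 3).over K) ∧ c = latticeGraphIso σ ϖ ((StdForm.antidiagonal 3).over K) κ ⟨latt (Matrix.diagonal ![(1 : K), 1, ϖ]), 2, isVertexLattice_two_N₁_of_neg hσϖ hϖ⟩ ∧ Valued.v ((ϖ ^ d₀)⁻¹ * pairing σ ((StdForm.antidiagonal 3).over K) (((κ : GL (Fin 3) K) : Matrix (Fin 3) (Fin 3) K) *ᵥ Pi.single 0 1) ((((γ : GL (Fin 3) K) : Matrix (Fin 3) (Fin 3) K) - 1) *ᵥ (((κ : GL (Fin 3) K) : Matrix (Fin 3) (Fin 3) K) *ᵥ Pi.single 0 1))) < 1}).ncard = νE)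
    (hνP : ({c : {M : Submodule 𝒪[K] (Fin 3 → K) // IsVertex σ ϖ ((StdForm.antidiagonal 3).over K) M} | (latticeGraph σ ϖ ((StdForm.antidiagonal 3).over K)).Adj (⟨stdLattice K 3, 0, isSelfDualLattice_stdLattice_three_of_v hϖ⟩ : {M : Submodule 𝒪[K] (Fin 3 → K) // IsVertex σ ϖ ((StdForm.antidiagonal 3).over K) M}) c ∧ (latticeGraph σ ϖ ((StdForm.antidiagonal 3).over K)).dist ⟨stdLattice K 3, 0, isSelfDualLattice_stdLattice_three_of_v hϖ⟩ c = (latticeGraph σ ϖ ((StdForm.antidiagonal 3).over K)).dist ⟨stdLattice K 3, 0, isSelfDualLattice_stdLattice_three_of_v hϖ⟩ (⟨stdLattice K 3, 0, isSelfDualLattice_stdLattice_three_of_v hϖ⟩ : {M : Submodule 𝒪[K] (Fin 3 → K) // IsVertex σ ϖ ((StdForm.antidiagonal 3).over K) M}) + 1 ∧ ∃ κ : unitaryGroupOfForm σ ((StdForm.antidiagonal 3).over K), κ ∈ unitaryInt σ ((StdForm.antidiagonal 3).over K) ∧ c = latticeGraphIso σ ϖ ((StdForm.antidiagonal 3).over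 K) κ ⟨latt (Matrix.diagonal ![(1 : K), 1, ϖ]), 2, isVertexLattice_two_N₁_of_neg hσϖ hϖ⟩ ∧ (∃ a : K, Valued.v a = 1 ∧ Valued.v (((ϖ ^ d₀)⁻¹ * pairing σ ((StdForm.antidiagonal 3).over K) (((κ : GL (Fin 3) K) : Matrix (Fin 3) (Fin 3) K) *ᵥ Pi.single 0 1) ((((γ : GL (Fin 3) K) : Matrix (Fin 3) (Fin 3) K) - 1) *ᵥ (((κ : GL (Fin 3) K) : Matrix (Fin 3) (Fin 3) K) *ᵥ Pi.single 0 1))) - (-c₁) * a ^ 2) < 1)}).ncard = νP)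
    (hνM : ({c : {M : Submodule 𝒪[K] (Fin 3 → K) // IsVertex σ ϖ ((StdForm.antidiagonal 3).over K) M} | (latticeGraph σ ϖ ((StdForm.antidiagonal 3).over K)).Adj (⟨stdLattice K 3, 0, isSelfDualLattice_stdLattice_three_of_v hϖ⟩ : {M : Submodule 𝒪[K] (Fin 3 → K) // IsVertex σ ϖ ((StdForm.antidiagonal 3).over K) M}) c ∧ (latticeGraph σ ϖ ((StdForm.antidiagonal 3).over K)).dist ⟨stdLattice K 3, 0, isSelfDualLattice_stdLattice_three_of_v hϖ⟩ c = (latticeGraph σ ϖ ((StdForm.antidiagonal 3).over K)).dist ⟨stdLattice K 3, 0, isSelfDualLattice_stdLattice_three_of_v hϖ⟩ (⟨stdLattice K 3, 0, isSelfDualLattice_stdLattice_three_of_v hϖ⟩ : {M : Submodule 𝒪[K] (Fin 3 → K) // IsVertex σ ϖ ((StdForm.antidiagonal 3).over K) M}) + 1 ∧ ∃ κ : unitaryGroupOfForm σ ((StdForm.antidiagonal 3).over K), κ ∈ unitaryInt σ ((StdForm.antidiagonal 3).over K) ∧ c = latticeGraphIso σ ϖ ((StdForm.antidiagonal 3).over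 K) κ ⟨latt (Matrix.diagonal ![(1 : K), 1, ϖ]), 2, isVertexLattice_two_N₁_of_neg hσϖ hϖ⟩ ∧ (∃ a : K, Valued.v a = 1 ∧ Valued.v (((ϖ ^ d₀)⁻¹ * pairing σ ((StdForm.antidiagonal 3).over K) (((κ : GL (Fin 3) K) : Matrix (Fin 3) (Fin 3) K) *ᵥ Pi.single 0 1) ((((γ : GL (Fin 3) K) : Matrix (Fin 3) (Fin 3) K) - 1) *ᵥ (((κ : GL (Fin 3) K) : Matrix (Fin 3) (Fin 3) K) *ᵥ Pi.single 0 1))) - (-(c₁ * ε)) * a ^ 2) < 1)}).ncard = νM) :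
    ({w | w ∈ {w | ∃ c, ((latticeGraph σ ϖ ((StdForm.antidiagonal 3).over K)).Adj (⟨stdLattice K 3, 0, isSelfDualLattice_stdLattice_three_of_v hϖ⟩ : {M : Submodule 𝒪[K] (Fin 3 → K) // IsVertex σ ϖ ((StdForm.antidiagonal 3).over K) M}) c ∧ (latticeGraph σ ϖ ((StdForm.antidiagonal 3).over K)).dist ⟨stdLattice K 3, 0, isSelfDualLattice_stdLattice_three_of_v hϖ⟩ c = (latticeGraph σ ϖ ((StdForm.antidiagonal 3).over K)).dist ⟨stdLattice K 3, 0, isSelfDualLattice_stdLattice_three_of_v hϖ⟩ (⟨stdLattice K 3, 0, isSelfDualLattice_stdLattice_three_of_v hϖ⟩ : {M : Submodule 𝒪[K] (Fin 3 → K) // IsVertex σ ϖ ((StdForm.antidiagonal 3).over K) M}) + 1 ∧ latticeGraphIso σ ϖ ((StdForm.antidiagonal 3).over K) γ c = c) ∧ ((latticeGraph σ ϖ ((StdForm.antidiagonal 3).over K)).Adj c w ∧ (latticeGraph σ ϖ ((StdForm.antidiagonal 3).over K)).dist ⟨stdLattice K 3, 0, isSelfDualLattice_stdLattice_three_of_v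 hϖ⟩ w = (latticeGraph σ ϖ ((StdForm.antidiagonal 3).over K)).dist ⟨stdLattice K 3, 0, isSelfDualLattice_stdLattice_three_of_v hϖ⟩ c + 1 ∧ latticeGraphIso σ ϖ ((StdForm.antidiagonal 3).over K) γ w = w)} ∧ (¬ w.1.map ((Matrix.toLin' (((γ : GL (Fin 3) K) : Matrix (Fin 3) (Fin 3) K) - 1)).restrictScalars 𝒪[K]) ≤ scaleLattice (ϖ ^ d₀) w.1 ∧ (w.1.map ((Matrix.toLin' (((γ : GL (Fin 3) K) : Matrix (Fin 3) (Fin 3) K) - 1)).restrictScalars 𝒪[K]) ≤ scaleLattice (ϖ ^ (d₀ - 1)) w.1 ∧ ¬ w.1.map ((Matrix.toLin' (((γ : GL (Fin 3) K) : Matrix (Fin 3) (Fin 3) K) - 1)).restrictScalars 𝒪[K]) ≤ scaleLattice (ϖ ^ d₀) w.1))}).ncard = Nat.card 𝓀[K] * νE ∧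
      ({w | w ∈ {w | ∃ c, ((latticeGraph σ ϖ ((StdForm.antidiagonal 3).over K)).Adj (⟨stdLattice K 3, 0, isSelfDualLattice_stdLattice_three_of_v hϖ⟩ : {M : Submodule 𝒪[K] (Fin 3 → K) // IsVertex σ ϖ ((StdForm.antidiagonal 3).over K) M}) c ∧ (latticeGraph σ ϖ ((StdForm.antidiagonal 3).over K)).dist ⟨stdLattice K 3, 0, isSelfDualLattice_stdLattice_three_of_v hϖ⟩ c = (latticeGraph σ ϖ ((StdForm.antidiagonal 3).over K)).dist ⟨stdLattice K 3, 0, isSelfDualLattice_stdLattice_three_of_v hϖ⟩ (⟨stdLattice K 3, 0, isSelfDualLattice_stdLattice_three_of_v hϖ⟩ : {M : Submodule 𝒪[K] (Fin 3 → K) // IsVertex σ ϖ ((StdForm.antidiagonal 3).over K) M}) + 1 ∧ latticeGraphIso σ ϖ ((StdForm.antidiagonal 3).over K) γ c = c) ∧ ((latticeGraph σ ϖ ((StdForm.antidiagonal 3).over K)).Adj c w ∧ (latticeGraph σ ϖ ((StdForm.antidiagonal 3).over K)).dist ⟨stdLattice K 3, 0, isSelfDualLattice_stdLattice_three_of_v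 hϖ⟩ w = (latticeGraph σ ϖ ((StdForm.antidiagonal 3).over K)).dist ⟨stdLattice K 3, 0, isSelfDualLattice_stdLattice_three_of_v hϖ⟩ c + 1 ∧ latticeGraphIso σ ϖ ((StdForm.antidiagonal 3).over K) γ w = w)} ∧ (¬ w.1.map ((Matrix.toLin' (((γ : GL (Fin 3) K) : Matrix (Fin 3) (Fin 3) K) - 1)).restrictScalars 𝒪[K]) ≤ scaleLattice (ϖ ^ d₀) w.1 ∧ (w.1.map ((Matrix.toLin' (((γ : GL (Fin 3) K) : Matrix (Fin 3) (Fin 3) K) - 1)).restrictScalars 𝒪[K]) ≤ scaleLattice (ϖ ^ (d₀ - 2)) w.1 ∧ ¬ w.1.map ((Matrix.toLin' (((γ : GL (Fin 3) K) : Matrix (Fin 3) (Fin 3) K) - 1)).restrictScalars 𝒪[K]) ≤ scaleLattice (ϖ ^ (d₀ - 1)) w.1) ∧ ∃ y ∈ w.1, ∃ a : K, Valued.v a = 1 ∧ Valued.v ((ϖ ^ (d₀ - 2))⁻¹ * pairing σ ((StdForm.antidiagonal 3).over K) y ((((γ : GL (Fin 3) K) : Matrix (Fin 3) (Fin 3)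 K) - 1) *ᵥ y) - (c₁) * a ^ 2) < 1)}).ncard = Nat.card 𝓀[K] * νP ∧
      ({w | w ∈ {w | ∃ c, ((latticeGraph σ ϖ ((StdForm.antidiagonal 3).over K)).Adj (⟨stdLattice K 3, 0, isSelfDualLattice_stdLattice_three_of_v hϖ⟩ : {M : Submodule 𝒪[K] (Fin 3 → K) // IsVertex σ ϖ ((StdForm.antidiagonal 3).over K) M}) c ∧ (latticeGraph σ ϖ ((StdForm.antidiagonal 3).over K)).dist ⟨stdLattice K 3, 0, isSelfDualLattice_stdLattice_three_of_v hϖ⟩ c = (latticeGraph σ ϖ ((StdForm.antidiagonal 3).over K)).dist ⟨stdLattice K 3, 0, isSelfDualLattice_stdLattice_three_of_v hϖ⟩ (⟨stdLattice K 3, 0, isSelfDualLattice_stdLattice_three_of_v hϖ⟩ : {M : Submodule 𝒪[K] (Fin 3 → K) // IsVertex σ ϖ ((StdForm.antidiagonal 3).over K) M}) + 1 ∧ latticeGraphIso σ ϖ ((StdForm.antidiagonal 3).over K) γ c = c) ∧ ((latticeGraph σ ϖ ((StdForm.antidiagonal 3).over K)).Adj c w ∧ (latticeGraph σ ϖ ((StdForm.antidiagonal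 3).over K)).dist ⟨stdLattice K 3, 0, isSelfDualLattice_stdLattice_three_of_v hϖ⟩ w = (latticeGraph σ ϖ ((StdForm.antidiagonal 3).over K)).dist ⟨stdLattice K 3, 0, isSelfDualLattice_stdLattice_three_of_v hϖ⟩ c + 1 ∧ latticeGraphIso σ ϖ ((StdForm.antidiagonal 3).over K) γ w = w)} ∧ (¬ w.1.map ((Matrix.toLin' (((γ : GL (Fin 3) K) : Matrix (Fin 3) (Fin 3) K) - 1)).restrictScalars 𝒪[K]) ≤ scaleLattice (ϖ ^ d₀) w.1 ∧ (w.1.map ((Matrix.toLin' (((γ : GL (Fin 3) K) : Matrix (Fin 3) (Fin 3) K) - 1)).restrictScalars 𝒪[K]) ≤ scaleLattice (ϖ ^ (d₀ - 2)) w.1 ∧ ¬ w.1.map ((Matrix.toLin' (((γ : GL (Fin 3) K) : Matrix (Fin 3) (Fin 3) K) - 1)).restrictScalars 𝒪[K]) ≤ scaleLattice (ϖ ^ (d₀ - 1)) w.1) ∧ ¬ (∃ y ∈ w.1, ∃ a : K, Valued.v a = 1 ∧ Valued.v ((ϖ ^ (d₀ - 2))⁻¹ * pairing σ ((StdForm.antidiagonal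 3).over K) y ((((γ : GL (Fin 3) K) : Matrix (Fin 3) (Fin 3) K) - 1) *ᵥ y) - (c₁) * a ^ 2) < 1))}).ncard = Nat.card 𝓀[K] * νM := by
  have hB : ∀ i j, Valued.v (((B₀ : Matrix (Fin 2) (Fin 2) K) - 1) i j) ≤ Valued.v (ϖ ^ d₀) := fun i j => by rw [map_pow]; exact hBm i j
  have hne := fun (κ : unitaryGroupOfForm σ ((StdForm.antidiagonal 3).over K)) (hκ : κ ∈ unitaryInt σ ((StdForm.antidiagonal 3).over K)) => not_eigenline_root_of_lt_v_det hvσ hϖ B₀ hγ hB hχ κ hκ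
  have hfix : latticeGraphIso σ ϖ ((StdForm.antidiagonal 3).over K) γ (⟨stdLattice K 3, 0, isSelfDualLattice_stdLattice_three_of_v hϖ⟩ : {M : Submodule 𝒪[K] (Fin 3 → K) // IsVertex σ ϖ ((StdForm.antidiagonal 3).over K) M}) = ⟨stdLattice K 3, 0, isSelfDualLattice_stdLattice_three_of_v hϖ⟩ := by
    apply Subtype.ext
    rw [latticeGraphIso_apply_coe]
    exact mapGL_stdLattice_of_mem_unitaryInt hγ0
  refine offRegion_tokenSlices_of_lineCounts_of_odd hσ hvσ hσϖ hϖ hres h2 hT hγ0 hd3 hodd hnil3 c₁ ε hc₁ hεv hε 1 (latticeGraphIso_one_apply _).symm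
    (isSelfDualLattice_stdLattice_three_of_v hϖ) hfix hroot νE νP νM ?_ ?_ ?_
  · refine (congrArg Set.ncard ?_).trans hνE
    ext c
    simp only [Set.mem_setOf_eq, one_mul, inv_one, mul_one]
    constructor
    · rintro ⟨h1, h2', κ, hκ, hc, -, hv⟩; exact ⟨h1, h2', κ, hκ, hc, hv⟩
    · rintro ⟨h1, h2', κ, hκ, hc, hv⟩; exact ⟨h1, h2', κ, hκ, hc, hne κ hκ, hv⟩
  · refine (congrArg Set.ncard ?_).trans hνP
    ext c
    simp only [Set.mem_setOf_eq, one_mul, inv_one, mul_one]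
    constructor
    · rintro ⟨h1, h2', κ, hκ, hc, -, hv⟩; exact ⟨h1, h2', κ, hκ, hc, hv⟩
    · rintro ⟨h1, h2', κ, hκ, hc, hv⟩; exact ⟨h1, h2', κ, hκ, hc, hne κ hκ, hv⟩
  · refine (congrArg Set.ncard ?_).trans hνM
    ext c
    simp only [Set.mem_setOf_eq, one_mul, inv_one, mul_one]
    constructor
    · rintro ⟨h1, h2', κ, hκ, hc, -, hv⟩; exact ⟨h1, h2', κ, hκ, hc, hv⟩
    · rintro ⟨h1, h2', κ, hκ, hc, hv⟩; exact ⟨h1, h2', κ, hκ, hc, hne κ hκ, hv⟩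

/-! ## §5 The root-region package at `ι(B₀, 1)`: `sR := {r₀}` and the three pooled sums (the `sR hsR PE PP PM hPE hPP hPM` inputs of ★ p849224 ∕ ★ p849287) -/

set_option maxHeartbeats 1600000 in -- budget only: statement-heavy lattice tokens.
/-- **THE ROOT-REGION PACKAGE OF THE HYPERBOLIC LITERAL AT THE TOP ODD LEVEL** — the `(sR, hsR, PE, PP, PM, hPE, hPP, hPM)` inputs of ★ p849224
`strataCount_J₀_of_charpoly_block_raw_endoGL_one` ∕ ★ p849287 `hyperbolicTotal_zero_ram_of_region_census_odd` (F0P3a-p08 (g20)) at `γ = ι(B₀, 1)` with `sR := {r₀}`,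
`(PE, PP, PM) := q·(νE, νP, νM)` from VALUE-ONLY root line counts (§3 + §4; `q = Nat.card 𝓀`).  The finite half (`νE ∈ {0, 2}` by `χ(det B̄₀)`, `νE + νP + νM = q + 1`, class
cross law) is F0P3a-p02 (g18)'s; the `HS` bridge is the chair's. [cite: Kottwitz1986, §3] [cite: Rogawski1990, §4.9 pp. 54–56] [cite: LabesseLanglands1979, §2] -/
theorem rootRegionPackage_hyperbolic_of_lineCounts [IsPrincipalIdealRing 𝒪[K]] (hσ : ∀ x, σ (σ x) = x) (hvσ : ∀ a, Valued.v (σ a) = Valued.v a) (hσϖ : σ ϖ = -ϖ)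
    (hϖ : Valued.v ϖ = WithZero.exp (-1 : ℤ)) (hres : ∀ x : K, Valued.v x ≤ 1 → Valued.v (σ x - x) < 1) (h2 : Valued.v (2 : K) = 1) [Finite 𝓀[K]]
    (hT : (latticeGraph σ ϖ ((StdForm.antidiagonal 3).over K)).IsTree)
    {γ : unitaryGroupOfForm σ ((StdForm.antidiagonal 3).over K)} (hγ0 : γ ∈ unitaryInt σ ((StdForm.antidiagonal 3).over K))
    (B₀ : GL (Fin 2) K) (hγ : (γ : GL (Fin 3) K) = endoGL (B₀, (1 : GL (Fin 1) K)))
    {d₀ : ℕ} (hd3 : 3 ≤ d₀) (hodd : Odd d₀)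
    (hnil3 : ∀ (w : {M : Submodule 𝒪[K] (Fin 3 → K) // IsVertex σ ϖ ((StdForm.antidiagonal 3).over K) M}) (e : ℕ), e + 1 ≤ d₀ →
      w.1.map ((Matrix.toLin' (((γ : GL (Fin 3) K) : Matrix (Fin 3) (Fin 3) K) - 1)).restrictScalars 𝒪[K]) ≤ scaleLattice (ϖ ^ e) w.1 →
      w.1.map ((Matrix.toLin' ((((γ : GL (Fin 3) K) : Matrix (Fin 3) (Fin 3) K) - 1) ^ 3)).restrictScalars 𝒪[K]) ≤ scaleLattice (ϖ ^ (3 * e + 1)) w.1)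
    (hBm : ∀ i j, Valued.v (((B₀ : Matrix (Fin 2) (Fin 2) K) - 1) i j) ≤ Valued.v ϖ ^ d₀)
    (hχ : ∀ t : K, Valued.v (t - 1) ≤ Valued.v (ϖ ^ d₀) →
      Valued.v ϖ ^ (2 * d₀ + 1) < Valued.v (((B₀ : Matrix (Fin 2) (Fin 2) K) - t • (1 : Matrix (Fin 2) (Fin 2) K)).det))
    (hroot : (stdLattice K 3).map ((Matrix.toLin' (((γ : GL (Fin 3) K) : Matrix (Fin 3) (Fin 3) K) - 1)).restrictScalars 𝒪[K]) ≤ scaleLattice (ϖ ^ d₀) (stdLattice K 3))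
    (hWtop : {B : Submodule 𝒪[K] (Fin 2 → K) | IsSelfDualLattice σ ϖ (!![(0 : K), 1; 1, 0] : Matrix (Fin 2) (Fin 2) K) B ∧ mapGL B₀ B = B ∧
        B.map ((Matrix.toLin' ((B₀ : Matrix (Fin 2) (Fin 2) K) - 1)).restrictScalars 𝒪[K]) ≤ scaleLattice (ϖ ^ d₀) B} = {stdLattice K 2})
    (c₁ ε : K) (hc₁ : Valued.v c₁ = 1) (hεv : Valued.v ε = 1) (hε : ∀ z : K, Valued.v z ≤ 1 → Valued.v (z ^ 2 - ε) = 1)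
    (νE νP νM : ℕ)
    (hνE : ({c : {M : Submodule 𝒪[K] (Fin 3 → K) // IsVertex σ ϖ ((StdForm.antidiagonal 3).over K) M} | (latticeGraph σ ϖ ((StdForm.antidiagonal 3).over K)).Adj (⟨stdLattice K 3, 0, isSelfDualLattice_stdLattice_three_of_v hϖ⟩ : {M : Submodule 𝒪[K] (Fin 3 → K) // IsVertex σ ϖ ((StdForm.antidiagonal 3).over K) M}) c ∧ (latticeGraph σ ϖ ((StdForm.antidiagonal 3).over K)).dist ⟨stdLattice K 3, 0, isSelfDualLattice_stdLattice_three_of_v hϖ⟩ c = (latticeGraph σ ϖ ((StdForm.antidiagonal 3).over K)).dist ⟨stdLattice K 3, 0, isSelfDualLattice_stdLattice_three_of_v hϖ⟩ (⟨stdLattice K 3, 0, isSelfDualLattice_stdLattice_three_of_v hϖ⟩ : {M : Submodule 𝒪[K] (Fin 3 → K) // IsVertex σ ϖ ((StdForm.antidiagonal 3).over K) M}) + 1 ∧ ∃ κ : unitaryGroupOfForm σ ((StdForm.antidiagonal 3).over K), κ ∈ unitaryInt σ ((StdForm.antidiagonal 3).over K) ∧ c = latticeGraphIso σ ϖ ((StdForm.antidiagonal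 3).over K) κ ⟨latt (Matrix.diagonal ![(1 : K), 1, ϖ]), 2, isVertexLattice_two_N₁_of_neg hσϖ hϖ⟩ ∧ Valued.v ((ϖ ^ d₀)⁻¹ * pairing σ ((StdForm.antidiagonal 3).over K) (((κ : GL (Fin 3) K) : Matrix (Fin 3) (Fin 3) K) *ᵥ Pi.single 0 1) ((((γ : GL (Fin 3) K) : Matrix (Fin 3) (Fin 3) K) - 1) *ᵥ (((κ : GL (Fin 3) K) : Matrix (Fin 3) (Fin 3) K) *ᵥ Pi.single 0 1))) < 1}).ncard = νE)
    (hνP : ({c : {M : Submodule 𝒪[K] (Fin 3 → K) // IsVertex σ ϖ ((StdForm.antidiagonal 3).over K) M} | (latticeGraph σ ϖ ((StdForm.antidiagonal 3).over K)).Adj (⟨stdLattice K 3, 0, isSelfDualLattice_stdLattice_three_of_v hϖ⟩ : {M : Submodule 𝒪[K] (Fin 3 → K) // IsVertex σ ϖ ((StdForm.antidiagonal 3).over K) M}) c ∧ (latticeGraph σ ϖ ((StdForm.antidiagonal 3).over K)).dist ⟨stdLattice K 3, 0, isSelfDualLattice_stdLattice_three_of_v hϖ⟩ c = (latticeGraph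 σ ϖ ((StdForm.antidiagonal 3).over K)).dist ⟨stdLattice K 3, 0, isSelfDualLattice_stdLattice_three_of_v hϖ⟩ (⟨stdLattice K 3, 0, isSelfDualLattice_stdLattice_three_of_v hϖ⟩ : {M : Submodule 𝒪[K] (Fin 3 → K) // IsVertex σ ϖ ((StdForm.antidiagonal 3).over K) M}) + 1 ∧ ∃ κ : unitaryGroupOfForm σ ((StdForm.antidiagonal 3).over K), κ ∈ unitaryInt σ ((StdForm.antidiagonal 3).over K) ∧ c = latticeGraphIso σ ϖ ((StdForm.antidiagonal 3).over K) κ ⟨latt (Matrix.diagonal ![(1 : K), 1, ϖ]), 2, isVertexLattice_two_N₁_of_neg hσϖ hϖ⟩ ∧ (∃ a : K, Valued.v a = 1 ∧ Valued.v (((ϖ ^ d₀)⁻¹ * pairing σ ((StdForm.antidiagonal 3).over K) (((κ : GL (Fin 3) K) : Matrix (Fin 3) (Fin 3) K) *ᵥ Pi.single 0 1) ((((γ : GL (Fin 3) K) : Matrix (Fin 3) (Fin 3) K) - 1) *ᵥ (((κ : GL (Fin 3) K) : Matrix (Fin 3) (Fin 3) K) *ᵥ Pi.single 0 1))) - (-c₁)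 * a ^ 2) < 1)}).ncard = νP)
    (hνM : ({c : {M : Submodule 𝒪[K] (Fin 3 → K) // IsVertex σ ϖ ((StdForm.antidiagonal 3).over K) M} | (latticeGraph σ ϖ ((StdForm.antidiagonal 3).over K)).Adj (⟨stdLattice K 3, 0, isSelfDualLattice_stdLattice_three_of_v hϖ⟩ : {M : Submodule 𝒪[K] (Fin 3 → K) // IsVertex σ ϖ ((StdForm.antidiagonal 3).over K) M}) c ∧ (latticeGraph σ ϖ ((StdForm.antidiagonal 3).over K)).dist ⟨stdLattice K 3, 0, isSelfDualLattice_stdLattice_three_of_v hϖ⟩ c = (latticeGraph σ ϖ ((StdForm.antidiagonal 3).over K)).dist ⟨stdLattice K 3, 0, isSelfDualLattice_stdLattice_three_of_v hϖ⟩ (⟨stdLattice K 3, 0, isSelfDualLattice_stdLattice_three_of_v hϖ⟩ : {M : Submodule 𝒪[K] (Fin 3 → K) // IsVertex σ ϖ ((StdForm.antidiagonal 3).over K) M}) + 1 ∧ ∃ κ : unitaryGroupOfForm σ ((StdForm.antidiagonal 3).over K), κ ∈ unitaryInt σ ((StdForm.antidiagonal 3).over K) ∧ c = latticeGraphIso σ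 ϖ ((StdForm.antidiagonal 3).over K) κ ⟨latt (Matrix.diagonal ![(1 : K), 1, ϖ]), 2, isVertexLattice_two_N₁_of_neg hσϖ hϖ⟩ ∧ (∃ a : K, Valued.v a = 1 ∧ Valued.v (((ϖ ^ d₀)⁻¹ * pairing σ ((StdForm.antidiagonal 3).over K) (((κ : GL (Fin 3) K) : Matrix (Fin 3) (Fin 3) K) *ᵥ Pi.single 0 1) ((((γ : GL (Fin 3) K) : Matrix (Fin 3) (Fin 3) K) - 1) *ᵥ (((κ : GL (Fin 3) K) : Matrix (Fin 3) (Fin 3) K) *ᵥ Pi.single 0 1))) - (-(c₁ * ε)) * a ^ 2) < 1)}).ncard = νM) :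
    (∀ v, v ∈ ({⟨stdLattice K 3, 0, isSelfDualLattice_stdLattice_three_of_v hϖ⟩} : Finset {M : Submodule 𝒪[K] (Fin 3 → K) // IsVertex σ ϖ ((StdForm.antidiagonal 3).over K) M}) ↔ v ∈ {v : {M : Submodule 𝒪[K] (Fin 3 → K) // IsVertex σ ϖ ((StdForm.antidiagonal 3).over K) M} | latticeGraphIso σ ϖ ((StdForm.antidiagonal 3).over K) γ v = v ∧ IsSelfDualLattice σ ϖ ((StdForm.antidiagonal 3).over K) v.1 ∧ v.1.map ((Matrix.toLin' (((γ : GL (Fin 3) K) : Matrix (Fin 3) (Fin 3) K) - 1)).restrictScalars 𝒪[K]) ≤ scaleLattice (ϖ ^ d₀) v.1}) ∧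
    (∑ v ∈ ({⟨stdLattice K 3, 0, isSelfDualLattice_stdLattice_three_of_v hϖ⟩} : Finset {M : Submodule 𝒪[K] (Fin 3 → K) // IsVertex σ ϖ ((StdForm.antidiagonal 3).over K) M}), ({w | w ∈ {w | ∃ c, ((latticeGraph σ ϖ ((StdForm.antidiagonal 3).over K)).Adj v c ∧ (latticeGraph σ ϖ ((StdForm.antidiagonal 3).over K)).dist ⟨stdLattice K 3, 0, isSelfDualLattice_stdLattice_three_of_v hϖ⟩ c = (latticeGraph σ ϖ ((StdForm.antidiagonal 3).over K)).dist ⟨stdLattice K 3, 0, isSelfDualLattice_stdLattice_three_of_v hϖ⟩ v + 1 ∧ latticeGraphIso σ ϖ ((StdForm.antidiagonal 3).over K) γ c = c) ∧ ((latticeGraph σ ϖ ((StdForm.antidiagonal 3).over K)).Adj c w ∧ (latticeGraph σ ϖ ((StdForm.antidiagonal 3).over K)).dist ⟨stdLattice K 3, 0, isSelfDualLattice_stdLattice_three_of_v hϖ⟩ w = (latticeGraph σ ϖ ((StdForm.antidiagonal 3).over K)).dist ⟨stdLattice K 3, 0, isSelfDualLattice_stdLattice_three_of_v hϖ⟩ c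 + 1 ∧ latticeGraphIso σ ϖ ((StdForm.antidiagonal 3).over K) γ w = w)} ∧ (¬ w.1.map ((Matrix.toLin' (((γ : GL (Fin 3) K) : Matrix (Fin 3) (Fin 3) K) - 1)).restrictScalars 𝒪[K]) ≤ scaleLattice (ϖ ^ d₀) w.1 ∧ (w.1.map ((Matrix.toLin' (((γ : GL (Fin 3) K) : Matrix (Fin 3) (Fin 3) K) - 1)).restrictScalars 𝒪[K]) ≤ scaleLattice (ϖ ^ (d₀ - 1)) w.1 ∧ ¬ w.1.map ((Matrix.toLin' (((γ : GL (Fin 3) K) : Matrix (Fin 3) (Fin 3) K) - 1)).restrictScalars 𝒪[K]) ≤ scaleLattice (ϖ ^ d₀) w.1))}).ncard = Nat.card 𝓀[K] * νE) ∧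
    (∑ v ∈ ({⟨stdLattice K 3, 0, isSelfDualLattice_stdLattice_three_of_v hϖ⟩} : Finset {M : Submodule 𝒪[K] (Fin 3 → K) // IsVertex σ ϖ ((StdForm.antidiagonal 3).over K) M}), ({w | w ∈ {w | ∃ c, ((latticeGraph σ ϖ ((StdForm.antidiagonal 3).over K)).Adj v c ∧ (latticeGraph σ ϖ ((StdForm.antidiagonal 3).over K)).dist ⟨stdLattice K 3, 0, isSelfDualLattice_stdLattice_three_of_v hϖ⟩ c = (latticeGraph σ ϖ ((StdForm.antidiagonal 3).over K)).dist ⟨stdLattice K 3, 0, isSelfDualLattice_stdLattice_three_of_v hϖ⟩ v + 1 ∧ latticeGraphIso σ ϖ ((StdForm.antidiagonal 3).over K) γ c = c) ∧ ((latticeGraph σ ϖ ((StdForm.antidiagonal 3).over K)).Adj c w ∧ (latticeGraph σ ϖ ((StdForm.antidiagonal 3).over K)).dist ⟨stdLattice K 3, 0, isSelfDualLattice_stdLattice_three_of_v hϖ⟩ w = (latticeGraph σ ϖ ((StdForm.antidiagonal 3).over K)).dist ⟨stdLattice K 3, 0, isSelfDualLattice_stdLattice_three_of_v hϖ⟩ c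 + 1 ∧ latticeGraphIso σ ϖ ((StdForm.antidiagonal 3).over K) γ w = w)} ∧ (¬ w.1.map ((Matrix.toLin' (((γ : GL (Fin 3) K) : Matrix (Fin 3) (Fin 3) K) - 1)).restrictScalars 𝒪[K]) ≤ scaleLattice (ϖ ^ d₀) w.1 ∧ (w.1.map ((Matrix.toLin' (((γ : GL (Fin 3) K) : Matrix (Fin 3) (Fin 3) K) - 1)).restrictScalars 𝒪[K]) ≤ scaleLattice (ϖ ^ (d₀ - 2)) w.1 ∧ ¬ w.1.map ((Matrix.toLin' (((γ : GL (Fin 3) K) : Matrix (Fin 3) (Fin 3) K) - 1)).restrictScalars 𝒪[K]) ≤ scaleLattice (ϖ ^ (d₀ - 1)) w.1) ∧ ∃ y ∈ w.1, ∃ a : K, Valued.v a = 1 ∧ Valued.v ((ϖ ^ (d₀ - 2))⁻¹ * pairing σ ((StdForm.antidiagonal 3).over K) y ((((γ : GL (Fin 3) K) : Matrix (Fin 3) (Fin 3) K) - 1) *ᵥ y) - (c₁) * a ^ 2) < 1)}).ncard = Nat.card 𝓀[K] * νP) ∧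
    (∑ v ∈ ({⟨stdLattice K 3, 0, isSelfDualLattice_stdLattice_three_of_v hϖ⟩} : Finset {M : Submodule 𝒪[K] (Fin 3 → K) // IsVertex σ ϖ ((StdForm.antidiagonal 3).over K) M}), ({w | w ∈ {w | ∃ c, ((latticeGraph σ ϖ ((StdForm.antidiagonal 3).over K)).Adj v c ∧ (latticeGraph σ ϖ ((StdForm.antidiagonal 3).over K)).dist ⟨stdLattice K 3, 0, isSelfDualLattice_stdLattice_three_of_v hϖ⟩ c = (latticeGraph σ ϖ ((StdForm.antidiagonal 3).over K)).dist ⟨stdLattice K 3, 0, isSelfDualLattice_stdLattice_three_of_v hϖ⟩ v + 1 ∧ latticeGraphIso σ ϖ ((StdForm.antidiagonal 3).over K) γ c = c) ∧ ((latticeGraph σ ϖ ((StdForm.antidiagonal 3).over K)).Adj c w ∧ (latticeGraph σ ϖ ((StdForm.antidiagonal 3).over K)).dist ⟨stdLattice K 3, 0, isSelfDualLattice_stdLattice_three_of_v hϖ⟩ w = (latticeGraph σ ϖ ((StdForm.antidiagonal 3).over K)).dist ⟨stdLattice K 3, 0, isSelfDualLattice_stdLattice_three_of_v hϖ⟩ c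 + 1 ∧ latticeGraphIso σ ϖ ((StdForm.antidiagonal 3).over K) γ w = w)} ∧ (¬ w.1.map ((Matrix.toLin' (((γ : GL (Fin 3) K) : Matrix (Fin 3) (Fin 3) K) - 1)).restrictScalars 𝒪[K]) ≤ scaleLattice (ϖ ^ d₀) w.1 ∧ (w.1.map ((Matrix.toLin' (((γ : GL (Fin 3) K) : Matrix (Fin 3) (Fin 3) K) - 1)).restrictScalars 𝒪[K]) ≤ scaleLattice (ϖ ^ (d₀ - 2)) w.1 ∧ ¬ w.1.map ((Matrix.toLin' (((γ : GL (Fin 3) K) : Matrix (Fin 3) (Fin 3) K) - 1)).restrictScalars 𝒪[K]) ≤ scaleLattice (ϖ ^ (d₀ - 1)) w.1) ∧ ¬ (∃ y ∈ w.1, ∃ a : K, Valued.v a = 1 ∧ Valued.v ((ϖ ^ (d₀ - 2))⁻¹ * pairing σ ((StdForm.antidiagonal 3).over K) y ((((γ : GL (Fin 3) K) : Matrix (Fin 3) (Fin 3) K) - 1) *ᵥ y) - (c₁) * a ^ 2) < 1))}).ncard = Nat.card 𝓀[K] * νM) := by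
  have hϖ0' : Valued.v ϖ ≠ 0 := by rw [hϖ]; exact WithZero.exp_ne_zero
  have hϖ0 : ϖ ≠ 0 := fun h0 => by rw [h0, map_zero] at hϖ0'; exact hϖ0' rfl
  have hu1 : Valued.v (((1 : GL (Fin 1) K) : Matrix (Fin 1) (Fin 1) K) 0 0) = 1 := by rw [Units.val_one, Matrix.one_apply_eq, map_one]
  have hud : Valued.v (((1 : GL (Fin 1) K) : Matrix (Fin 1) (Fin 1) K) 0 0 - 1) ≤ Valued.v (ϖ ^ d₀) := by
    rw [Units.val_one, Matrix.one_apply_eq, sub_self, map_zero]; exact zero_le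
  have hdet : Valued.v ϖ ^ (2 * d₀ + 1) <
      Valued.v (((B₀ : Matrix (Fin 2) (Fin 2) K) - ((1 : GL (Fin 1) K) : Matrix (Fin 1) (Fin 1) K) 0 0 • (1 : Matrix (Fin 2) (Fin 2) K)).det) := by
    rw [Units.val_one, Matrix.one_apply_eq]
    exact hχ 1 (by rw [sub_self, map_zero]; exact zero_le)
  have hR := eq_root_of_mem_rootRegion_of_lt_v_det hσ hvσ hϖ γ hγ0 B₀ (1 : GL (Fin 1) K) hγ hu1 hud hdet hroot hWtop
  obtain ⟨hE, hP, hM⟩ := rootSlices_hyperbolic_of_lineCounts hσ hvσ hσϖ hϖ hres h2 hT hγ0 B₀ hγ hd3 hodd hnil3 hBm hχ hroot c₁ ε hc₁ hεv hε νE νP νM hνE hνP hνM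
  have hfix : latticeGraphIso σ ϖ ((StdForm.antidiagonal 3).over K) γ (⟨stdLattice K 3, 0, isSelfDualLattice_stdLattice_three_of_v hϖ⟩ : {M : Submodule 𝒪[K] (Fin 3 → K) // IsVertex σ ϖ ((StdForm.antidiagonal 3).over K) M}) = ⟨stdLattice K 3, 0, isSelfDualLattice_stdLattice_three_of_v hϖ⟩ := by
    apply Subtype.ext
    rw [latticeGraphIso_apply_coe]
    exact mapGL_stdLattice_of_mem_unitaryInt hγ0
  refine ⟨fun v => ⟨fun hv => ?_, fun hv => ?_⟩, ?_, ?_, ?_⟩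
  · rw [Finset.mem_singleton] at hv
    rw [hv]
    exact ⟨hfix, isSelfDualLattice_stdLattice_three_of_v hϖ, hroot⟩
  · rw [Finset.mem_singleton]; exact hR v hv
  · rw [Finset.sum_singleton]; exact hE
  · rw [Finset.sum_singleton]; exact hP
  · rw [Finset.sum_singleton]; exact hM

end Literature.NumberTheory.Rogawski1990.TypeOneRamifiedJunction

end
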